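import Summits.BirchSwinnertonDyer.BirchSwinnertonDyer.Theorems.ByReductionTypeAtTwoMultTransportFrobenius
import Literature.NumberTheory.EllipticCurves.CyclotomicTowerLocalFrobeniusProofs
import Literature.NumberTheory.EllipticCurves.OrdinaryLocalReductionMapProofs
import Literature.NumberTheory.EllipticCurves.SubgroupSelmer
import HarnessLib

/-!
# Route `ByReductionTypeAtTwo`, crux `MultUpperHalfAtTwo` (item stmt-BirchSwinnertonDyer-19922), TOWER road, the
# «ONE BIT AT A NON-SPLIT 2» rows: KERNEL BRICK 10 — an element of `H_∞ = Gal(ℚ̄₂/ℚ_{2,∞})` FLIPS `√γ` at a non-split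
# multiplicative `2` (the twist character of the Tate uniformisation is non-trivial on the local cyclotomic tower)

HONEST FRAMING (cell `bsd-2adic`, run/shared/lean/pub/bsd-2adic/, seat `bsd-2adic-tower-1` GEN 8, HUMAN RULINGS
D-0036 / D-0054 / D-0074): TOOL theorems only (no definition, no named fact, no `sorry`); closes nothing by itself;
nothing booked; BSD is not proved by any of this. Step S1 of the KERNELISATION of the displayed MEMO binder
`MultTowerNS2.localTowerKerTwoTorsion_le_two_nonsplitTwo_of_tateUnit` (scope HOME/tower/SCOPE-hNS2one-kernel-GEN8.md): with
`Ψ : K̄_vˣ → E(K̄_v)`, `σ • Ψ(u) = χ(σ) Ψ(σ u)`, `χ(σ) = +1` iff `σ t = t` (tree THEOREM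
`TateCurve.exists_twistedTateUniformisation_tateJ`), the fixed points `E(K̄_v)^{H_∞}` over the local cyclotomic `ℤ₂`-tower
`ℚ_{2,∞} = K̄_v^{H_∞}`, `H_∞ = localSubgroup κ.kerSubgroup ℚ_v`, are the σ-ANTI-invariants of `(ℚ_{2,∞}K₂)ˣ/q^ℤ` — provided
`χ` is NON-TRIVIAL ON `H_∞`. This file proves exactly that: some `τ ∈ H_∞` has `τ t = −t`. Proof: the tree's
`ZpExtension.IsCyclotomic.exists_isArithFrobAt_resGal_mem_kerSubgroup` («`ℚ_∞/ℚ` is totally ramified at 2»: an arithmetic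
FROBENIUS `τ` of `ℚ_v` lies in `H_∞`) and seat t42's `MultTransportAtTwo.frob_smul_sqrt_gamma_eq_neg_two` (every arithmetic
Frobenius flips `√γ` at a non-split multiplicative `2`).

* `exists_mem_localSubgroup_kerSubgroup_smul_sqrt_gamma_eq_neg` — the statement; `…_layerSubgroup_…` — hence in every `H_n`.

References: Silverman *ATAEC* V Lemma 5.2 (c), Thm. 5.3, Ex. 5.11; Washington §13.1; Greenberg LNM 1716 §3 p. 89;
scope memo SCOPE-hNS2one-kernel-GEN8.md S1.
-/

set_option autoImplicit false
-- the Theorems namespace of this sub repeats the summit name by design (D-0017 nested layout: Summit.<S>.<Sub>)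
set_option linter.dupNamespace false

noncomputable section

open scoped Classical

namespace Summit.BirchSwinnertonDyer.BirchSwinnertonDyer.Theorems.MultTowerNS2

open NumberField IsDedekindDomain Field WeierstrassCurve Literature.NumberTheory.EllipticCurves
  Literature.NumberTheory.GaloisRepresentations

variable (W : WeierstrassCurve ℚ) [W.IsElliptic] [W.IsGloballyMinimal] {κ : ZpExtension ℚ 2}

/-- **Some `τ ∈ H_∞ = Gal(ℚ̄₂/ℚ_{2,∞})` flips `√γ(W)`** at a NON-SPLIT multiplicative `2`: for the cyclotomic `ℤ₂`-extension
`κ`, the place `v ∋ 2` and every `t ∈ K̄_v` with `t² = γ(W) = −c₄/c₆`, there is `τ` in the local kernel subgroup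
`localSubgroup κ.kerSubgroup ℚ_v` (restriction in `ker κ = Gal(ℚ̄/ℚ_∞)`) with `τ • t = −t` — an arithmetic Frobenius of
`ℚ_v` lying in `H_∞` (total ramification of `2` in `ℚ_∞`, tree
`ZpExtension.IsCyclotomic.exists_isArithFrobAt_resGal_mem_kerSubgroup`), which flips `t` by seat t42's
`MultTransportAtTwo.frob_smul_sqrt_gamma_eq_neg_two`. [cite: SilvermanATAEC1994, Ch. V Lemma 5.2 (c), Thm. 5.3, Ex. 5.11]
[cite: Washington1997, §13.1] -/
theorem exists_mem_localSubgroup_kerSubgroup_smul_sqrt_gamma_eq_neg (hκ : κ.IsCyclotomic)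
    (hmult : W.HasMultiplicativeReductionAtPrime 2) (hns : ¬ W.HasSplitMultiplicativeReductionAtPrime 2)
    (v : HeightOneSpectrum (𝓞 ℚ)) (h2v : ((2 : ℕ) : 𝓞 ℚ) ∈ v.asIdeal)
    (t : AlgebraicClosure (v.adicCompletion ℚ))
    (ht : t ^ 2 = algebraMap (v.adicCompletion ℚ) (AlgebraicClosure (v.adicCompletion ℚ))
      (algebraMap ℚ (v.adicCompletion ℚ) (-(W.c₄ / W.c₆)))) :
    ∃ τ : absoluteGaloisGroup (v.adicCompletion ℚ),
      τ ∈ localSubgroup κ.kerSubgroup (v.adicCompletion ℚ) ∧ τ • t = -t := by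
  obtain ⟨𝔐, h𝔐⟩ := v.localPrimesAbove_nonempty
  obtain ⟨w, hw⟩ := v.exists_spectralValuation
  have hϖ : Irreducible ((2 : ℕ) : v.adicCompletionIntegers ℚ) :=
    IsDedekindDomain.HeightOneSpectrum.irreducible_natCast_adicCompletionIntegers_rat h2v
  obtain ⟨τ, hτF, hτker⟩ := hκ.exists_isArithFrobAt_resGal_mem_kerSubgroup hw h𝔐 h2v hϖ
  exact ⟨τ, (mem_localSubgroup_iff κ.kerSubgroup (v.adicCompletion ℚ) τ).mpr hτker,
    MultTransportAtTwo.frob_smul_sqrt_gamma_eq_neg_two W hmult hns h2v h𝔐 hτF t ht⟩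

/-- **… hence in every local layer subgroup `H_n`** (`H_∞ ≤ H_n`): the twist character of the Tate uniformisation is
non-trivial on `Gal(ℚ̄₂/ℚ_{2,n})` for every `n` — `E` stays NON-SPLIT over every layer `ℚ_{2,n}` (Greenberg, LNM 1716, §3
p. 93: the caveat "E can become split over `(F_n)_{v_n}`" does not occur over `ℚ`). [cite: GreenbergLNM1716, §3 p. 93]
[cite: Washington1997, §13.1] -/
theorem exists_mem_localSubgroup_layerSubgroup_smul_sqrt_gamma_eq_neg (hκ : κ.IsCyclotomic)
    (hmult : W.HasMultiplicativeReductionAtPrime 2) (hns : ¬ W.HasSplitMultiplicativeReductionAtPrime 2)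
    (v : HeightOneSpectrum (𝓞 ℚ)) (h2v : ((2 : ℕ) : 𝓞 ℚ) ∈ v.asIdeal) (n : ℕ)
    (t : AlgebraicClosure (v.adicCompletion ℚ))
    (ht : t ^ 2 = algebraMap (v.adicCompletion ℚ) (AlgebraicClosure (v.adicCompletion ℚ))
      (algebraMap ℚ (v.adicCompletion ℚ) (-(W.c₄ / W.c₆)))) :
    ∃ τ : absoluteGaloisGroup (v.adicCompletion ℚ),
      τ ∈ localSubgroup (κ.layerSubgroup n) (v.adicCompletion ℚ) ∧ τ • t = -t := by
  obtain ⟨τ, hτ, hflip⟩ :=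
    exists_mem_localSubgroup_kerSubgroup_smul_sqrt_gamma_eq_neg W hκ hmult hns v h2v t ht
  exact ⟨τ, localSubgroup_ker_le_layer κ (v.adicCompletion ℚ) n hτ, hflip⟩

end Summit.BirchSwinnertonDyer.BirchSwinnertonDyer.Theorems.MultTowerNS2

end
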